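import Literature.AlgebraicGeometry.Resolution.DiscreteUnramifiedHenselGenerator
import Mathlib.FieldTheory.IntermediateField.Adjoin.Algebra
import HarnessLib

/-!
# A Hensel-root generator of `K` over the rational base `k(t, s)`
# (stmt-ResolutionOfSingularities-16088, line `birth`, branch DiscreteRange, S2)

Let `k` be a perfect field, `K / k` a finitely generated field extension, `O ⊆ K` a valuation
ring containing `k` whose valuation is DISCRETE with uniformizer `t` (every non-zero value is an
integral power of `v(t) < 1`) and whose residue field is algebraic over `k`, and let
`L = k(t, s) ⊆ K` (S1: a separating transcendence basis `{t} ∪ s ⊆ O`) with `K / L` separable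
algebraic. Then `K = L(η)` for a HENSEL ROOT `η ∈ O` over `O_L = O ∩ L`: a root of a monic
polynomial `f` with coefficients in `O ∩ L` such that `f'(η)` is a unit of `O`.

Proof. `O ∩ L` is a discrete valuation ring (or `L`, in the degenerate case `t = 0`) with the
SAME uniformizer `t ∈ L` — `e = 1` — (`isPrincipalIdealRing_comap_of_valuation_eq_pow`: a
non-zero ideal is generated by an element of least `t`-order), both residue fields are algebraic
over the perfect field `k`, so the residue extension is separable, and `K / L` is finite
separable; hence `O` is étale-local over `O ∩ L` and the generic theorem
`Literature.AlgebraicGeometry.Resolution.exists_henselRoot_generator` (Knaf–Kuhlmann 2009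
Lemma 3.7 (2), (3) / Knaf–Kuhlmann 2005 §5 "`O_F = A_q`, `A = O_E[x]_{g(x)}` standard-étale",
proved there through Mathlib's local structure theorem for unramified algebras
`Algebra.IsUnramifiedAt.exists_hasStandardEtaleSurjectionOn`) yields `η` and `f`. The output
is verbatim the input of `isSmoothlyUniformizableIn_of_henselRoot`
(`Literature/AlgebraicGeometry/Resolution/LocalEtaleUniformization.lean`), consumed by S5.

References: H. Knaf, F.-V. Kuhlmann, Adv. Math. 221 (2009), Lemma 3.7; Ann. Sci. ÉNS 38
(2005), §5; M. Raynaud, *Anneaux locaux henséliens*, LNM 169, X Thm. 1.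
-/

noncomputable section

-- single-problem summit: the doubled namespace component `ResolutionOfSingularities` is forced
set_option linter.dupNamespace false

open Polynomial

namespace Summit.ResolutionOfSingularities.ResolutionOfSingularities.Theorems.IndSmoothBirth

/-! ## Discreteness: `O ∩ L` is a principal ideal ring -/

/-- If every non-zero element of a valuation ring `O` of `K` has value a natural power of the
value of a fixed `t` with `v(t) ≤ 1`, then for every subfield `L` (given as `algebraMap L K`)
the valuation ring `O ∩ L` of `L` is a principal ideal ring: a non-zero ideal is generated by
any of its elements of least `t`-order. [folklore] -/
theorem isPrincipalIdealRing_comap_of_valuation_eq_pow {L K : Type*} [Field L] [Field K]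
    [Algebra L K] (O : ValuationSubring K) {t : K} (ht1 : O.valuation t ≤ 1)
    (hnat : ∀ x : K, x ∈ O → x ≠ 0 → ∃ m : ℕ, O.valuation x = O.valuation t ^ m) :
    IsPrincipalIdealRing (O.comap (algebraMap L K)) := by
  classical
  refine ⟨fun I => ?_⟩
  by_cases hI : I = ⊥
  · rw [hI]; exact bot_isPrincipal
  have hK0 : ∀ x : O.comap (algebraMap L K), x ≠ 0 → algebraMap L K x ≠ 0 := fun x hx h =>
    hx (Subtype.ext ((map_eq_zero _).mp h))
  have hex : ∃ m : ℕ, ∃ x ∈ I, x ≠ 0 ∧ O.valuation (algebraMap L K x) = O.valuation t ^ m := by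
    obtain ⟨x, hxI, hx0⟩ := Submodule.exists_mem_ne_zero_of_ne_bot hI
    obtain ⟨m, hm⟩ := hnat _ x.2 (hK0 x hx0)
    exact ⟨m, x, hxI, hx0, hm⟩
  obtain ⟨x, hxI, hx0, hx⟩ := Nat.find_spec hex
  refine ⟨⟨x, le_antisymm (fun y hy => ?_) ((Ideal.span_singleton_le_iff_mem _).mpr hxI)⟩⟩
  by_cases hy0 : y = 0
  · rw [hy0]; exact zero_mem _
  obtain ⟨m, hm⟩ := hnat _ y.2 (hK0 y hy0)
  have hmin : Nat.find hex ≤ m := Nat.find_min' hex ⟨y, hy, hy0, hm⟩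
  have hle : O.valuation (algebraMap L K y) ≤ O.valuation (algebraMap L K x) := by
    rw [hm, hx]
    exact pow_le_pow_right_of_le_one' ht1 hmin
  have hxL : (x : L) ≠ 0 := fun h => hx0 (Subtype.ext h)
  have hq : algebraMap L K ((y : L) / x) ∈ O := by
    rw [map_div₀, ← O.valuation_le_one_iff, map_div₀]
    exact div_le_one_of_le₀ hle zero_le
  refine Ideal.mem_span_singleton'.mpr ⟨⟨(y : L) / x, hq⟩, Subtype.ext ?_⟩
  exact div_mul_cancel₀ (y : L) hxL

/-! ## S2: the Hensel-root generator -/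

/-- **S2 (`stub_dr_henselGenerator`) of the DiscreteRange branch.** Let `k` be perfect, `K/k`
finitely generated, `O` a valuation ring of `K` containing `k`, `t ∈ O` and `s ⊆ O` finite with
`K` separable algebraic over `L = k(t, s)`, and suppose the valuation is DISCRETE with
uniformizer `t` (every non-zero value is an integral power of `v(t) < 1`) and its residue
field is algebraic over `k` (every `x ∈ O` satisfies `v(g(x)) < 1` for a monic `g ∈ k[X]`).
Then `K = L(η)` for some `η ∈ O` which is a HENSEL ROOT over `O ∩ L`: a root of a monic
`f ∈ K[X]` with coefficients in `O ∩ L` and `v(f'(η)) = 1`. Indeed `O ∩ L` is a discrete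
valuation ring with the same uniformizer `t ∈ L` (`e = 1`), the residue extension is separable
(everything is algebraic over the perfect `k`), so `O` is étale-local over `O ∩ L` and
`Literature.AlgebraicGeometry.Resolution.exists_henselRoot_generator` (Knaf–Kuhlmann 2009
Lemma 3.7 / Knaf–Kuhlmann 2005 §5, via Mathlib's local structure of unramified algebras)
applies. [cite: KnafKuhlmann2009, Lemma 3.7] -/
theorem stub_dr_henselGenerator (k K : Type) [Field k] [PerfectField k] [Field K] [Algebra k K]
    (hK : (⊤ : IntermediateField k K).FG) (O : ValuationSubring K)
    (hO : ∀ c : k, algebraMap k K c ∈ O) (t : K) (s : Finset K) (htO : t ∈ O) (hsO : ∀ y ∈ s, y ∈ O)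
    (hsep : Algebra.IsSeparable ↥(IntermediateField.adjoin k (insert t (↑s : Set K))) K)
    (halg : Algebra.IsAlgebraic ↥(IntermediateField.adjoin k (insert t (↑s : Set K))) K)
    (hunif : ∀ x : K, x ≠ 0 → ∃ n : ℤ, O.valuation x = O.valuation t ^ n)
    (hlt : O.valuation t < 1)
    (hres : ∀ x : K, x ∈ O → ∃ g : Polynomial k, g.Monic ∧ O.valuation (Polynomial.aeval x g) < 1) :
    ∃ η : K, η ∈ O ∧
      Subfield.closure (((IntermediateField.adjoin k (insert t (↑s : Set K))).toSubfield : Set K) ∪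
        {η}) = ⊤ ∧
      ∃ f : Polynomial K, f.Monic ∧
        (∀ i, f.coeff i ∈ O ∧ f.coeff i ∈ IntermediateField.adjoin k (insert t (↑s : Set K))) ∧
        f.eval η = 0 ∧ O.valuation ((Polynomial.derivative f).eval η) = 1 := by
  have _hsO := hsO
  have _htO := htO
  set L : IntermediateField k K := IntermediateField.adjoin k (insert t (↑s : Set K)) with hL
  haveI := hsep
  haveI := halg
  have htL : t ∈ L := IntermediateField.subset_adjoin k _ (Set.mem_insert t _)
  -- `K / L` is finite
  haveI : Algebra.EssFiniteType k K := IntermediateField.fg_top_iff.mp hK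
  haveI : Algebra.EssFiniteType L K := Algebra.EssFiniteType.of_comp k L K
  haveI : FiniteDimensional L K := Algebra.finite_of_essFiniteType_of_isAlgebraic (F := L) (E := K)
  -- discreteness: values of non-zero elements of `O` are natural powers of `v(t)`
  have hnat : ∀ x : K, x ∈ O → x ≠ 0 → ∃ m : ℕ, O.valuation x = O.valuation t ^ m := by
    intro x hxO hx0
    obtain ⟨n, hn⟩ := hunif x hx0
    rcases le_or_gt 0 n with hn0 | hn0
    · exact ⟨n.toNat, by rw [hn, ← zpow_natCast, Int.toNat_of_nonneg hn0]⟩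
    · exfalso
      by_cases ht0 : t = 0
      · rw [ht0, Valuation.map_zero, zero_zpow n hn0.ne] at hn
        exact hx0 ((Valuation.zero_iff _).mp hn)
      · have h1 : 1 < O.valuation x :=
          hn ▸ one_lt_zpow_of_neg₀ ((Valuation.pos_iff _).mpr ht0) hlt hn0
        exact not_le.mpr h1 ((O.valuation_le_one_iff x).mpr hxO)
  haveI : IsPrincipalIdealRing (O.comap (algebraMap L K)) :=
    isPrincipalIdealRing_comap_of_valuation_eq_pow O hlt.le hnat
  -- `e = 1`: every element of the maximal ideal of `O` is a multiple of `t`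
  have ht : ∀ y : K, O.valuation y < 1 → O.valuation y ≤ O.valuation t := by
    intro y hy
    by_cases hy0 : y = 0
    · rw [hy0, Valuation.map_zero]; exact zero_le
    obtain ⟨m, hm⟩ := hnat y ((O.valuation_le_one_iff y).mp hy.le) hy0
    have hm0 : m ≠ 0 := by
      rintro rfl
      rw [pow_zero] at hm
      exact hy.ne hm
    rw [hm, ← Nat.succ_pred_eq_of_ne_zero hm0, pow_succ]
    exact mul_le_of_le_one_left' (pow_le_one₀ zero_le hlt.le)
  obtain ⟨η, hηO, hgen, f, hfm, hcoeff, hfη, hf'⟩ :=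
    Literature.AlgebraicGeometry.Resolution.exists_henselRoot_generator (k := k) (L := L) O hO
      hres (t := (⟨t, htL⟩ : L)) hlt ht
  have hrange : Set.range (algebraMap L K) = ((L.toSubfield : Set K)) := by
    ext x
    exact ⟨fun ⟨y, hy⟩ => hy ▸ y.2, fun hx => ⟨⟨x, hx⟩, rfl⟩⟩
  refine ⟨η, hηO, hrange ▸ hgen, f, hfm, fun i => ⟨(hcoeff i).1, ?_⟩, hfη, hf'⟩
  obtain ⟨y, hy⟩ := (hcoeff i).2
  rw [← hy]
  exact y.2

end Summit.ResolutionOfSingularities.ResolutionOfSingularities.Theorems.IndSmoothBirth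

end
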